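import Summits.ResolutionOfSingularities.ResolutionOfSingularities.Theorems.WeightedInvariantKeyRungThreeOfDescentFiniteResidue
import Summits.ResolutionOfSingularities.ResolutionOfSingularities.Theorems.WeightedInvariantIota3EpsTorus
import Summits.ResolutionOfSingularities.ResolutionOfSingularities.Theorems.WeightedInvariantIota3SigmaGenericFibre
import Mathlib.RingTheory.KrullDimension.Polynomial
import HarnessLib

/-!
# The two σ-inputs `hσ` and (σ-pt) of `stub_keyRungGrHomLE_three` are ONE statement: σ is invariant along 𝔪-PRESERVING essentially smooth local
# homomorphisms of regular local rings into dimension ≤ 3 (door `HypersurfaceCentreConstruction`, stmt-ResolutionOfSingularities-19897; audit glue)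

Topic: `Summits/ResolutionOfSingularities/ResolutionOfSingularities/Theorems`. Helper for the door item `HypersurfaceCentreConstruction`
(stmt-ResolutionOfSingularities-19897, route `WeightedInvariant`), line `local-engine` (skeleton v3.12 `7a4b52ef`), def-free.  Sequel of
`keyRungGrHomLE_three_of_descent''` (…KeyRungThreeOfDescentFiniteResidue, p818362).  Its two σ-hypotheses are

* `hσ(fin)` — `σ(T(X), g) ≤ σ(T, g)` along the generic fibre point `T → T(X) = T[X]_{𝔪T[X]}` (consumed by hc10), and
* (σ-pt) — `σ(S'_{𝔮'}, f) = σ(S_{𝔮' ∩ S}, f)` at every prime `𝔮'` of the target of a local formally smooth e.f.t. `φ : S → S'`, `dim S' ≤ 3` (consumed by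
  hc11 — but ONLY at `𝔮' = P S'`, `P` the generic prime of the top `ι₀`-stratum of `(S, f)`, where `(P S') ∩ S = P`).

Both are instances of ONE statement **(σ-ext)**: for `φ : A → A'` local, formally smooth, essentially of finite type between regular local rings with
`dim A' ≤ 3` AND `𝔪_A A' = 𝔪_{A'}`: `σ(A', φ g) = σ(A, g)`.  Indeed `T → T(X)` is such a `φ` (`Iota3.map_maximalIdeal_genericFibre`; `dim T(X) = dim T`), and so is
the localised map `S_P → S'_{P S'}` whenever `(P S') ∩ S = P` (§2).  (σ-ext) at equal dimension three is the LEVEL-LETTER descent of res-type-057 / res-L1-w43-stub-3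
(the ratio letter is `JFlatEssSmooth.iotaSigmaRatio_algebraMap_eq`; the level letter needs σ-maximiser descent, memo O53-DESC-CEX); at `dim A ≤ 2` and at
infinite residue fields along `T → T(X)` it is partly in the tree (…Iota3SigmaPointwise, …Iota3SigmaFlagSpecialise).

* §1 `Iota3.sigma_genericFibre_le_of_sigmaExt` — `hσ` (all regular local `T`, `dim T ≤ 3`) ⟸ (σ-ext).
* §2 `Iota3.iotaSigma_atPrime_map_eq_of_sigmaExt` — (σ-pt) at the primes `P S'` with `(P S') ∩ S = P` ⟸ (σ-ext).
* §3 `Iota3.iotaJEssSmoothCompatibleLE_three_of_sigmaExt` — hc11 ⟸ (desc-τ) ∧ (σ-ext) ∧ GAP 2.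
* §4 **`keyRungGrHomLE_three_of_sigmaExt`** — THE GAP LIST WITH FIVE HYPOTHESES: (desc-τ), (σ-ext), GAP 2, hgame, the residue of the dominance word at the
  power positions.  (The door-typed split of the σ-input — finite residue fields, `T` e.f.t. over a perfect field — stays available as
  `keyRungGrHomLE_three_of_descent_door`, …KeyRungThreeOfDescentDoor.)

[OURS · L1 W4.3 · audit glue]  Replaces the role of NO printed item; NOT a statement of the manuscript under review [claim: Hironaka2017, status:
under-review]; candidates stay candidates; AI work, weaker than expert review.  No definition; no axiom; every input is a hypothesis.

## References

* H. Matsumura, *Commutative Ring Theory* (1987), Thm. 4.3, §8, §15. [Matsumura1987]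
* H. Hironaka, *Characteristic polyhedra of singularities*, J. Math. Kyoto Univ. 7 (1967), §3. [Hironaka1967]
-/

noncomputable section

set_option linter.dupNamespace false -- mandated namespace `Summit.<Summit>.<Problem>` of this single-conjunct summit

open IsLocalRing Literature.AlgebraicGeometry.Resolution Polynomial
open Summit.ResolutionOfSingularities.ResolutionOfSingularities.Theorems
open Summit.ResolutionOfSingularities.ResolutionOfSingularities.Theorems.ContactCylinder

namespace Summit.ResolutionOfSingularities.ResolutionOfSingularities.Cruxes.HypersurfaceCentreConstruction.LocalEngine

namespace Iota3

section SigmaExt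

variable
  (hσext : ∀ (A A' : Type) [CommRing A] [IsRegularLocalRing A] [CommRing A'] [IsRegularLocalRing A'] [Algebra A A']
    [IsLocalHom (algebraMap A A')] [Algebra.FormallySmooth A A'] [Algebra.EssFiniteType A A'] (g : A),
    ringKrullDim A' ≤ 3 → (maximalIdeal A).map (algebraMap A A') = maximalIdeal A' → iotaSigma A' (algebraMap A A' g) = iotaSigma A g)
include hσext

/-! ## §1 `hσ` ⟸ (σ-ext) -/

/-- **`hσ` FROM (σ-ext)**: `σ(T(X), C g) ≤ σ(T, g)` (indeed `=`) for every regular local `T` of dimension `≤ 3` — `T → T(X)` is local, formally smooth,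
essentially of finite type, `𝔪_T T(X) = 𝔪_{T(X)}` and `dim T(X) = dim T`. [OURS · audit glue] -/
theorem sigma_genericFibre_le_of_sigmaExt :
    ∀ (T : Type) [CommRing T] [IsRegularLocalRing T] (g : T)
      [((maximalIdeal T).map (C : T →+* T[X])).IsPrime], ringKrullDim T ≤ 3 →
      iotaSigma (Localization.AtPrime ((maximalIdeal T).map (C : T →+* T[X])))
        (algebraMap T[X] (Localization.AtPrime ((maximalIdeal T).map (C : T →+* T[X]))) (C g)) ≤ iotaSigma T g := by
  intro S _ _ f _ hdim
  have h𝔮 : ((maximalIdeal S).map (C : S →+* S[X])).comap (C : S →+* S[X]) = maximalIdeal S :=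
    ((maximalIdeal.isMaximal S).eq_of_le Ideal.IsPrime.ne_top' Ideal.le_comap_map).symm
  have hdimX : ringKrullDim (Localization.AtPrime ((maximalIdeal S).map (C : S →+* S[X]))) ≤ 3 := by
    rw [IsLocalization.AtPrime.ringKrullDim_eq_height ((maximalIdeal S).map (C : S →+* S[X]))
      (Localization.AtPrime ((maximalIdeal S).map (C : S →+* S[X]))), Polynomial.height_map_C,
      IsLocalRing.maximalIdeal_height_eq_ringKrullDim]
    exact hdim
  haveI := isRegularLocalRing_localization_polynomial S ((maximalIdeal S).map (C : S →+* S[X]))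
  haveI := isLocalHom_algebraMap_localization_polynomial S ((maximalIdeal S).map (C : S →+* S[X])) h𝔮
  haveI := formallySmooth_localization_polynomial S ((maximalIdeal S).map (C : S →+* S[X]))
  haveI := essFiniteType_localization_polynomial S ((maximalIdeal S).map (C : S →+* S[X]))
  have h := hσext S (Localization.AtPrime ((maximalIdeal S).map (C : S →+* S[X]))) f hdimX map_maximalIdeal_genericFibre
  rw [algebraMap_genericFibre_apply] at h
  exact h.le

/-! ## §2 (σ-pt) at the primes `P S'` with `(P S') ∩ S = P` ⟸ (σ-ext) -/

/-- **(σ-pt) AT AN EXTENDED PRIME FROM (σ-ext)**: `φ : S → S'` local, formally smooth, essentially of finite type between regular local rings,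
`dim S' ≤ 3`; `P ⊂ S` prime with `P S'` prime and `(P S') ∩ S = P`.  Then `σ(S'_{P S'}, f) = σ(S_P, f)` — the localised map `S_P → S'_{P S'}` is
local, formally smooth, essentially of finite type, and `𝔪_{S_P} S'_{P S'} = P S'_{P S'} = 𝔪_{S'_{P S'}}`. [OURS · audit glue] -/
theorem iotaSigma_atPrime_map_eq_of_sigmaExt (S S' : Type) [CommRing S] [IsRegularLocalRing S] [CommRing S'] [IsRegularLocalRing S']
    [Algebra S S'] [Algebra.FormallySmooth S S'] [Algebra.EssFiniteType S S'] (hdimS' : ringKrullDim S' ≤ 3) (f : S)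
    (P : Ideal S) [P.IsPrime] [(P.map (algebraMap S S')).IsPrime] (hcomap : (P.map (algebraMap S S')).comap (algebraMap S S') = P) :
    iotaSigma (Localization.AtPrime (P.map (algebraMap S S'))) (algebraMap S (Localization.AtPrime (P.map (algebraMap S S'))) f) =
      iotaSigma (Localization.AtPrime P) (algebraMap S (Localization.AtPrime P) f) := by
  set 𝔮' : Ideal S' := P.map (algebraMap S S') with h𝔮'def
  haveI : IsRegularLocalRing (Localization.AtPrime 𝔮') := isRegularLocalRing_localization_atPrime S' 𝔮'
  haveI : IsRegularLocalRing (Localization.AtPrime P) := isRegularLocalRing_localization_atPrime S _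
  letI : Algebra (Localization.AtPrime P) (Localization.AtPrime 𝔮') :=
    (Localization.localRingHom P 𝔮' (algebraMap S S') hcomap.symm).toAlgebra
  haveI : IsScalarTower S (Localization.AtPrime P) (Localization.AtPrime 𝔮') :=
    IsScalarTower.of_algebraMap_eq fun s => by
      change _ = Localization.localRingHom P 𝔮' (algebraMap S S') hcomap.symm (algebraMap S _ s)
      rw [Localization.localRingHom_to_map, IsScalarTower.algebraMap_apply S S' (Localization.AtPrime 𝔮')]
  haveI : IsLocalHom (algebraMap (Localization.AtPrime P) (Localization.AtPrime 𝔮')) :=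
    Localization.isLocalHom_localRingHom P 𝔮' (algebraMap S S') hcomap.symm
  haveI : Algebra.FormallySmooth S (Localization.AtPrime 𝔮') := Algebra.FormallySmooth.comp S S' _
  haveI : Algebra.EssFiniteType S (Localization.AtPrime 𝔮') := Algebra.EssFiniteType.comp S S' _
  haveI : Algebra.FormallySmooth (Localization.AtPrime P) (Localization.AtPrime 𝔮') :=
    Algebra.FormallySmooth.localization_base P.primeCompl
  haveI : Algebra.EssFiniteType (Localization.AtPrime P) (Localization.AtPrime 𝔮') := Algebra.EssFiniteType.of_comp S _ _
  have hdim𝔮' : ringKrullDim (Localization.AtPrime 𝔮') ≤ 3 := (ringKrullDim_localization_atPrime_le 𝔮').trans hdimS'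
  -- `𝔪_{S_P} S'_{𝔮'} = 𝔪_{S'_{𝔮'}}`
  have h𝔪 : (maximalIdeal (Localization.AtPrime P)).map (algebraMap (Localization.AtPrime P) (Localization.AtPrime 𝔮')) =
      maximalIdeal (Localization.AtPrime 𝔮') := by
    rw [← Localization.AtPrime.map_eq_maximalIdeal, Ideal.map_map,
      ← IsScalarTower.algebraMap_eq S (Localization.AtPrime P) (Localization.AtPrime 𝔮'),
      IsScalarTower.algebraMap_eq S S' (Localization.AtPrime 𝔮'), ← Ideal.map_map, Localization.AtPrime.map_eq_maximalIdeal]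
  rw [IsScalarTower.algebraMap_apply S (Localization.AtPrime P) (Localization.AtPrime 𝔮') f]
  exact hσext _ _ _ hdim𝔮' h𝔪

/-! ## §3 hc11 ⟸ (desc-τ) ∧ (σ-ext) ∧ GAP 2 -/

variable
  (hD : ∀ (T T' : Type) [CommRing T] [IsRegularLocalRing T] [CommRing T'] [IsRegularLocalRing T'] [Algebra T T']
    [IsLocalHom (algebraMap T T')] [Algebra.FormallySmooth T T'] [Algebra.EssFiniteType T T'] (g : T),
    ringKrullDim T' ≤ 3 → IsTiePosition T' (algebraMap T T' g) → IsTiePosition T g)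
include hD

/-- **THE GAP hc11 OF THE P3 RUNG FROM (desc-τ), (σ-ext) AND GAP 2** (`Iota3.iotaJEssSmoothCompatibleLE_three_of_sigmaPt` with (σ-pt) replaced by
(σ-ext), which the proof consumes only at the extended top-stratum prime, §2): `IotaJEssSmoothCompatibleLE 3 Iota3.iotaFlatT Iota3.jFlatT`.
[OURS · hc11 ⟸ (desc-τ) ∧ (σ-ext) ∧ GAP 2] -/
theorem iotaJEssSmoothCompatibleLE_three_of_sigmaExt
    (hgap2 : ∀ (T T' : Type) [CommRing T] [IsRegularLocalRing T] [CommRing T'] [IsRegularLocalRing T'] [Algebra T T']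
      [IsLocalHom (algebraMap T T')] [Algebra.FormallySmooth T T'] [Algebra.EssFiniteType T T'] (g : T),
      ringKrullDim T' ≤ 3 → (maximalIdeal T).map (algebraMap T T') = maximalIdeal T' → ringKrullDim T = (3 : ℕ) →
      iotaEps T g = 0 → ∀ m : ℕ, jSigmaPt T' (algebraMap T T' g) m = (jSigmaPt T g m).map (algebraMap T T')) :
    IotaJEssSmoothCompatibleLE 3 iotaFlatT jFlatT := by
  intro S S' _ _ _ _ _ _ _ _ f hdimS'
  classical
  haveI := isDomain_of_isRegularLocalRing S
  haveI := isDomain_of_isRegularLocalRing S'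
  haveI : Module.Flat S S' := IotaOrderEssSmooth.flat_of_formallySmooth_of_essFiniteType S S'
  haveI : Module.FaithfullyFlat S S' := Module.FaithfullyFlat.of_flat_of_isLocalHom
  have hτ : iotaTau S' (algebraMap S S' f) = iotaTau S f := iotaTau_essSmooth_eq_of_descent hD S S' f hdimS'
  have hτpt : ∀ (𝔮' : Ideal S') [𝔮'.IsPrime], iotaTau (Localization.AtPrime 𝔮') (algebraMap S (Localization.AtPrime 𝔮') f) =
      iotaTau (Localization.AtPrime (𝔮'.comap (algebraMap S S')))
        (algebraMap S (Localization.AtPrime (𝔮'.comap (algebraMap S S'))) f) :=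
    fun 𝔮' _ => iotaTau_atPrime_eq_of_descent hD S S' hdimS' f 𝔮'
  refine ⟨?_, fun m => JFlatEssSmooth.jFlatT_map_of_sigma S S' hdimS' f hτ hτpt
    (fun h𝔪 hdim hε => hgap2 S S' f hdimS' h𝔪 hdim hε) m⟩
  -- dimensions: `dim S ≤ dim S' ≤ 3`
  obtain ⟨a, b, c, ha, hb, -, hab⟩ := EssSmoothLE2.exists_dims S S'
  have hdimS : ringKrullDim S ≤ 3 := by
    have h : ((b : ℕ) : WithBot ℕ∞) ≤ 3 := hb ▸ hdimS'
    have hb3 : b ≤ 3 := by exact_mod_cast h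
    rw [ha]; exact_mod_cast (show a ≤ 3 by omega)
  -- the generic prime `P` of the top `ι₀`-stratum of `S`, with `P S'` prime
  have hP : ∃ (P : Ideal S) (_ : P.IsPrime) (_ : (P.map (algebraMap S S')).IsPrime),
      topStratum iotaOrdEpsTau S f = {𝔮 | P ≤ 𝔮.asIdeal} := by
    by_cases hf0 : f = 0
    · refine ⟨⊥, Ideal.isPrime_bot, by rw [Ideal.map_bot]; exact Ideal.isPrime_bot, ?_⟩
      subst hf0; exact topStratum_iotaOrdEpsTau_zero_eq_bot S hdimS
    by_cases hfu : IsUnit f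
    · exact ⟨⊥, Ideal.isPrime_bot, by rw [Ideal.map_bot]; exact Ideal.isPrime_bot, topStratum_iotaOrdEpsTau_of_isUnit_eq_bot S hdimS hfu⟩
    · have hf : f ∈ maximalIdeal S := (IsLocalRing.mem_maximalIdeal f).mpr (mem_nonunits_iff.mpr hfu)
      obtain ⟨P, hPp, hreg, -, hE⟩ := topStratum_iotaOrdEpsTau_eq hdimS hf0 hf
      haveI := hPp
      exact ⟨P, hPp, isPrime_map_of_isRegularLocalRing_quotient S S' P hreg, hE⟩
  obtain ⟨P, hPp, hP'p, hE⟩ := hP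
  have hE' := JFlatEssSmooth.topStratum_iotaOrdEpsTau_map_of_eq S S' f hτ hτpt hE
  have hcomap : (P.map (algebraMap S S')).comap (algebraMap S S') = P := Ideal.comap_map_eq_self_of_faithfullyFlat (B := S') P
  -- the invariant: `ι₀` and the cylinder
  rw [iotaFlatT_eq_iff]
  refine ⟨JFlatEssSmooth.iotaOrdEpsTau_map_eq_of_iotaTau S S' f hτ, ?_⟩
  rw [iotaCylinder_eq_of_topStratum_eq iotaOrdEpsTau iotaSigma _ _ hE', iotaCylinder_eq_of_topStratum_eq iotaOrdEpsTau iotaSigma _ _ hE,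
    ← IsScalarTower.algebraMap_apply S S' (Localization.AtPrime (P.map (algebraMap S S'))) f]
  exact iotaSigma_atPrime_map_eq_of_sigmaExt hσext S S' hdimS' f P hcomap

end SigmaExt

end Iota3

/-! ## §4 The gap list with five hypotheses -/

open Iota3 in
/-- **P3 RUNG FOR THE NAMED PAIR MODULO FIVE HYPOTHESES**: (desc-τ), (σ-ext) «σ is invariant along 𝔪-preserving local formally smooth e.f.t.
homomorphisms of regular local rings into dimension `≤ 3`», GAP 2, hgame, the residue of the dominance word at the power positions. [OURS · audit glue] -/
theorem keyRungGrHomLE_three_of_sigmaExt (p : ℕ)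
    (hD : ∀ (T T' : Type) [CommRing T] [IsRegularLocalRing T] [CommRing T'] [IsRegularLocalRing T'] [Algebra T T']
      [IsLocalHom (algebraMap T T')] [Algebra.FormallySmooth T T'] [Algebra.EssFiniteType T T'] (g : T),
      ringKrullDim T' ≤ 3 → IsTiePosition T' (algebraMap T T' g) → IsTiePosition T g)
    (hσext : ∀ (A A' : Type) [CommRing A] [IsRegularLocalRing A] [CommRing A'] [IsRegularLocalRing A'] [Algebra A A']
      [IsLocalHom (algebraMap A A')] [Algebra.FormallySmooth A A'] [Algebra.EssFiniteType A A'] (g : A),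
      ringKrullDim A' ≤ 3 → (maximalIdeal A).map (algebraMap A A') = maximalIdeal A' → iotaSigma A' (algebraMap A A' g) = iotaSigma A g)
    (hgap2 : ∀ (T T' : Type) [CommRing T] [IsRegularLocalRing T] [CommRing T'] [IsRegularLocalRing T'] [Algebra T T']
      [IsLocalHom (algebraMap T T')] [Algebra.FormallySmooth T T'] [Algebra.EssFiniteType T T'] (g : T),
      ringKrullDim T' ≤ 3 → (maximalIdeal T).map (algebraMap T T') = maximalIdeal T' → ringKrullDim T = (3 : ℕ) →
      iotaEps T g = 0 → ∀ m : ℕ, jSigmaPt T' (algebraMap T T' g) m = (jSigmaPt T g m).map (algebraMap T T'))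
    (hgame : CanonicalGameClauseHomLE 3 p iotaFlatT jFlatT)
    (hres : ∀ (k₀ : Type) [Field k₀] [CharP k₀ p] [PerfectField k₀]
      (S : Type) [CommRing S] [Algebra k₀ S] [Algebra.EssFiniteType k₀ S] [IsRegularLocalRing S] (f : S),
      ringKrullDim S = (3 : ℕ) → f ≠ 0 → f ∈ (maximalIdeal S) ^ 2 →
      ContactCylinder.topStratumPrime iotaOrdEpsTau S f = maximalIdeal S → iotaEps S f ≠ 1 →
      (∃ ℓ ∈ maximalIdeal S, f ∈ Ideal.span {ℓ ^ (adicOrder f).toNat} ⊔ maximalIdeal S ^ ((adicOrder f).toNat + 1)) →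
      ∀ (a b : ℕ), 0 < b →
      (∀ q' r₁' r₂' : ℕ, AdmissibleTriple q' r₁' r₂' → FlagReaches f (adicOrder f).toNat q' r₁' r₂' → r₁' * b ≤ a * r₂') →
      ∀ (g₁ g₂ g₁' g₂' : S) (q r₁ r₂ : ℕ), AdmissibleTriple q r₁ r₂ → r₁ * b = a * r₂ → q < r₂ → r₂ < r₁ →
        IsTwoFlag g₁ g₂ → IsTwoFlag g₁' g₂' →
        f ∈ flagContactFiltration g₁ g₂ q r₁ r₂ (r₁ * (adicOrder f).toNat) →
        f ∈ flagContactFiltration g₁' g₂' q r₁ r₂ (r₁ * (adicOrder f).toNat) →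
        g₂' ∈ flagContactFiltration g₁ g₂ q r₁ r₂ r₂) :
    KeyRungGrHomLE 3 p :=
  keyRungGrHomLE_three_of_residue_at_powers' p
    (iotaFlatT_torusFactorMonotoneLE_of_tauEssSmooth
      (fun T T' _ _ _ _ _ _ _ _ g hd => iotaTau_essSmooth_eq_of_descent hD T T' g hd) (sigma_genericFibre_le_of_sigmaExt hσext) p)
    (iotaJEssSmoothCompatibleLE_three_of_sigmaExt hσext hD hgap2) hgame hres (iotaFlatT_upperSemicontinuousGradedLE_three p)

end Summit.ResolutionOfSingularities.ResolutionOfSingularities.Cruxes.HypersurfaceCentreConstruction.LocalEngine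

end
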